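import Literature.Computability.MetaComplexity.GapMINKTSearchProofs
import Literature.Computability.MetaComplexity.GapMINKTDenseRandomAvgPProofs
import Literature.Computability.Complexity.UnaryBricks
import Literature.Computability.Complexity.IsqrtBrick
import Literature.Computability.Complexity.StackBricksStrings
import HarnessLib

/-!
# Cor. 4.22 (1 ⇒ 4) of Hirahara 2018: the parameter machines and the assembly (proofs)

Sibling proof file of `GapMINKTAverageCase.lean` (D-0014; the proofs cannot be appended to that
file itself because `GapMINKTSearch.lean`, which holds the glue, imports it). The named fact
`Hirahara2018_gapMINKT_mem_PromiseZPP` (Hirahara, FOCS 2018 Cor. I.2 = ECCC TR18-138 rev. 1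
Cor. 4.22, (1 ⇒ 4): *if `DistNP ⊆ AvgP` then `Gap_{σ,τ}MINKT ∈ Promise-ZPP` for some
`σ(n,s) = s + O((log n)√s + (log n)²)` and some polynomial `τ`*) is proved in print as the chain
(1 ⇒ 2) (`(MINKT[n-1], 𝒟^KT) ∈ DistNP ⊆ AvgP ⊆ Avg_{1/6m}P`) ⇒ 3 (Thm. 4.21: Lemma 4.17 + the
reconstruction step) ⇒ 4 (Fact 3.8), formalised as the glue `Hirahara2018_gapMINKT_mem_PromiseZPP_of`
(`GapMINKTSearch.lean`), which leaves two machine hypotheses `hσ`, `hτ`: the polynomial-time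
computability, with unary input `⟨1ⁿ, 1ˢ⟩` and unary output (`IsPolyTimeUnary₂`), of the explicit
threshold `sigmaBound c n s = s + c·(⌊log₂ n⌋·⌊√s⌋ + ⌊log₂ n⌋² + 1)` and of `(n, t) ↦ p(n + t)`.

This file

* proves `hσ` and `hτ` (`isPolyTimeUnary₂_sigmaBound`, `isPolyTimeUnary₂_eval_add`) in the algebra
  of `FP` bricks — `Brick.logFn` (`1ʷ ↦ 1^{⌊log₂ |w|⌋}`), `Brick.isqrtFn` read back in unary through
  `binToUnaryFn`, unary multiplication `HashBricks.umulFn`, concatenation `Brick.appF`, the constant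
  multiple `Brick.onesMulFn c`, and `Plumb.polyFn p` (`1ʷ ↦ 1^{p(|w|)}`) — via the transport lemma
  `isPolyTimeUnary₂_of_exists_FP`, with no new definition and no new Turing machine;
* assembles **Cor. 4.22 (1 ⇒ 4) from Thm. 4.21 alone**
  (`Hirahara2018_gapMINKT_mem_PromiseZPP_of_thm421`): every other printed ingredient is discharged in
  the tree — (1 ⇒ 2) `Hirahara2018_MINKTr_DKT_mem_AvgDeltaP_holds` (`GapMINKTDenseRandomAvgPProofs.lean`),
  Fact 3.8 `Hirahara2018_gapMINKT_mem_PromiseZPP_of_search_holds` (`GapMINKTSearchProofs.lean`) and the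
  machine hypotheses (this file) — so the discharge `Hirahara2018_gapMINKT_mem_PromiseZPP_holds` is
  exactly `Hirahara2018_gapMINKT_mem_PromiseZPP_of_thm421 Hirahara2018_gapMINKTSearch_of_AvgDeltaP_holds`
  once Thm. 4.21 (`Hirahara2018_gapMINKTSearch_of_AvgDeltaP`, `GapMINKTSearch.lean`), the one remaining
  named fact of the cone, is discharged. Inside Thm. 4.21, Lemma 4.17 is discharged
  (`Hirahara2018_dense_randomStrings_of_AvgDeltaP_holds`, `GapMINKTDenseRandomProofs.lean`) and the
  proved glue `Hirahara2018_gapMINKTSearch_of_AvgDeltaP_of` (`GapMINKTReconstruction.lean`) reduces it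
  to its reconstruction step (Cor. 4.12's Nisan–Wigderson reconstruction with a list-decodable code,
  Lemmas 3.9/4.19, Lemma 4.20), carried there as an explicit hypothesis. (History: that step was
  briefly a named fact of its own, `Hirahara2018_gapMINKTSearch_of_dense`, p18786; being a slice of
  the proof of Thm. 4.21 rather than a distinct published result, and a theory to prove, it was merged
  back into Thm. 4.21's obligation by the decomposition review of 2026-08-15, D-0026, and this file's
  assembly re-based on Thm. 4.21.)

## References

* S. Hirahara, *Non-black-box worst-case to average-case reductions within NP*, FOCS 2018, 247–258
  (Thm. I.1, Cor. I.2, Fact II.8); full version ECCC TR18-138 rev. 1 (2019), Thm. 4.21, Cor. 4.22,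
  Fact 3.8 [Hirahara2018].
* S. Arora, B. Barak, *Computational Complexity: A Modern Approach*, CUP 2009, §1.3 (closure of
  polynomial time under composition; unary and binary arithmetic) [AroraBarak2009].
-/

namespace Literature.Computability.MetaComplexity

open _root_.Computability Complexity Polynomial Brick

/-! ### Transport: an `FP` brick on `⟨1ⁿ, 1ˢ⟩` with unary values is an `IsPolyTimeUnary₂` machine -/

/-- If some `F ∈ FP` maps `⟨1ⁿ, 1ˢ⟩` to `1^{f(n,s)}` for all `n, s`, then `f` is efficiently
computable in the sense of Fact 3.8 (`IsPolyTimeUnary₂ f`: same machine, same polynomial, read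
through the unary encoders). [cite: AroraBarak2009, §1.3] -/
theorem isPolyTimeUnary₂_of_exists_FP {f : ℕ → ℕ → ℕ}
    (h : ∃ F ∈ FP, ∀ n s : ℕ,
      F (boolPair (unaryEncodeNat n) (unaryEncodeNat s)) = unaryEncodeNat (f n s)) :
    IsPolyTimeUnary₂ f := by
  obtain ⟨F, ⟨q, M, hM⟩, hF⟩ := h
  refine ⟨q, M, fun ns => ?_⟩
  have h := hM (boolPair (unaryEncodeNat ns.1) (unaryEncodeNat ns.2))
  simp only [id] at h
  rw [hF] at h
  exact h

/-! ### The machine hypotheses `hσ`, `hτ` of the glue -/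

/-- **The threshold machine.** An `FP` brick computing `⟨1ⁿ, 1ˢ⟩ ↦ 1^{sigmaBound c n s}`,
`sigmaBound c n s = s + c·(L·R + L² + 1)` with `L = ⌊log₂ n⌋ = |logFn 1ⁿ|` and
`R = ⌊√s⌋ = |binToUnaryFn ⟨1ˢ, isqrtFn 1ˢ⟩|` (the ruler `1ˢ` suffices as `⌊√s⌋ ≤ s`), the products in
unary by `HashBricks.umulFn`, the sums by concatenation `appF`, the multiple by `onesMulFn c`.
[cite: AroraBarak2009, §1.3] -/
theorem exists_FP_sigmaBound (c : ℕ) :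
    ∃ F ∈ FP, ∀ n s : ℕ,
      F (boolPair (unaryEncodeNat n) (unaryEncodeNat s)) = unaryEncodeNat (sigmaBound c n s) := by
  refine ⟨appF ∘ fanoutFn sndF (onesMulFn c ∘ (appF ∘ fanoutFn
      (HashBricks.umulFn ∘ fanoutFn (logFn ∘ fstF) (binToUnaryFn ∘ fanoutFn sndF (isqrtFn ∘ sndF)))
      (appF ∘ fanoutFn (HashBricks.umulFn ∘ fanoutFn (logFn ∘ fstF) (logFn ∘ fstF))
        fun _ => [true]))), ?_, fun n s => ?_⟩
  · exact comp_mem_FP appF_mem_FP (fanoutFn_mem_FP sndF_mem_FP (comp_mem_FP (onesMulFn_mem_FP c)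
      (comp_mem_FP appF_mem_FP (fanoutFn_mem_FP
        (comp_mem_FP HashBricks.umulFn_mem_FP (fanoutFn_mem_FP (comp_mem_FP logFn_mem_FP fstF_mem_FP)
          (comp_mem_FP binToUnaryFn_mem_FP
            (fanoutFn_mem_FP sndF_mem_FP (comp_mem_FP isqrtFn_mem_FP sndF_mem_FP)))))
        (comp_mem_FP appF_mem_FP (fanoutFn_mem_FP
          (comp_mem_FP HashBricks.umulFn_mem_FP (fanoutFn_mem_FP (comp_mem_FP logFn_mem_FP fstF_mem_FP)
            (comp_mem_FP logFn_mem_FP fstF_mem_FP)))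
          (const_mem_FP _)))))))
  · simp only [Function.comp_apply, fanoutFn_apply, fstF_boolPair, sndF_boolPair, appF_boolPair,
      HashBricks.umulFn_apply, logFn, isqrtFn_apply, binToUnaryFn_boolPair, bitsToNat_encodeNat,
      unaryEncodeNat_eq_replicate, List.length_replicate, onesMulFn,
      min_eq_left (Nat.sqrt_le_self _), sigmaBound, ones, ← List.replicate_succ',
      ← List.replicate_add, pow_two, Nat.add_assoc]

/-- **`σ = sigmaBound c` is efficiently computable** (unary in, unary out): hypothesis `hσ` of
`Hirahara2018_gapMINKT_mem_PromiseZPP_of`. [cite: Hirahara2018, Fact 3.8] -/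
theorem isPolyTimeUnary₂_sigmaBound (c : ℕ) : IsPolyTimeUnary₂ (sigmaBound c) :=
  isPolyTimeUnary₂_of_exists_FP (exists_FP_sigmaBound c)

/-- **The time-bound machine.** An `FP` brick computing `⟨1ⁿ, 1ᵗ⟩ ↦ 1^{p(n+t)}`: `Plumb.polyFn p`
after concatenation. [cite: AroraBarak2009, §1.3] -/
theorem exists_FP_eval_add (p : Polynomial ℕ) :
    ∃ F ∈ FP, ∀ n t : ℕ,
      F (boolPair (unaryEncodeNat n) (unaryEncodeNat t)) = unaryEncodeNat (p.eval (n + t)) :=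
  ⟨Plumb.polyFn p ∘ appF, comp_mem_FP (Plumb.polyFn_mem_FP p) appF_mem_FP, fun n t => by
    simp only [Function.comp_apply, appF_boolPair, Plumb.polyFn_apply, List.length_append,
      unaryEncodeNat_eq_replicate, List.length_replicate]⟩

/-- **`τ(n, t) = p(n + t)` is efficiently computable** (unary in, unary out): hypothesis `hτ` of
`Hirahara2018_gapMINKT_mem_PromiseZPP_of`. [cite: Hirahara2018, Fact 3.8] -/
theorem isPolyTimeUnary₂_eval_add (p : Polynomial ℕ) :
    IsPolyTimeUnary₂ fun n t => p.eval (n + t) :=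
  isPolyTimeUnary₂_of_exists_FP (exists_FP_eval_add p)

/-! ### Cor. 4.22 (1 ⇒ 4) from Thm. 4.21 -/

/-- **Cor. 4.22, (2 ⇒ 3 ⇒ 4) for explicit parameters, machine hypotheses discharged**: if
`(MINKT[n-1], 𝒟^KT) ∈ Avg_{1/6m}P` then `Gap_{σ,τ}MINKT ∈ PromiseZPP'` for `σ = sigmaBound c` and
`τ(n,t) = p(n+t)` for some `c, p` — `gapMINKT_sigmaBound_mem_PromiseZPP'_of_AvgDeltaP` with Fact 3.8
(`Hirahara2018_gapMINKT_mem_PromiseZPP_of_search_holds`) and the machine hypotheses `hσ`, `hτ`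
(`isPolyTimeUnary₂_sigmaBound`, `isPolyTimeUnary₂_eval_add`) discharged, leaving Thm. 4.21 (`h421`).
[cite: Hirahara2018, Cor. 4.22] -/
theorem gapMINKT_sigmaBound_mem_PromiseZPP'_of_thm421
    (h421 : Hirahara2018_gapMINKTSearch_of_AvgDeltaP) (U : UniversalMachine)
    (havg : (⟨U.MINKTr fun n => n - 1, DKT⟩ : DistProblem) ∈ AvgDeltaP (fun m => 1 / (6 * m))) :
    ∃ (c : ℕ) (p : Polynomial ℕ), (∀ n t, t ≤ p.eval (n + t)) ∧
      U.gapMINKT (sigmaBound c) (fun n t => p.eval (n + t)) ∈ PromiseZPP' :=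
  gapMINKT_sigmaBound_mem_PromiseZPP'_of_AvgDeltaP h421
    Hirahara2018_gapMINKT_mem_PromiseZPP_of_search_holds isPolyTimeUnary₂_sigmaBound
    isPolyTimeUnary₂_eval_add U havg

/-- **Hirahara 2018, Cor. 4.22 (1 ⇒ 4), reduced to Thm. 4.21.** All other printed ingredients are
discharged in the tree: (1 ⇒ 2) (`Hirahara2018_MINKTr_DKT_mem_AvgDeltaP_holds`), Fact 3.8
(`Hirahara2018_gapMINKT_mem_PromiseZPP_of_search_holds`) and the machine hypotheses
(`isPolyTimeUnary₂_sigmaBound`, `isPolyTimeUnary₂_eval_add`); the discharge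
`Hirahara2018_gapMINKT_mem_PromiseZPP_holds` is this theorem applied to
`Hirahara2018_gapMINKTSearch_of_AvgDeltaP_holds` once Thm. 4.21 is discharged (its Lemma 4.17 is,
`GapMINKTDenseRandomProofs.lean`; its reconstruction step is the open obligation, see
`GapMINKTReconstruction.lean`). [cite: Hirahara2018, Cor. 4.22] -/
theorem Hirahara2018_gapMINKT_mem_PromiseZPP_of_thm421
    (h421 : Hirahara2018_gapMINKTSearch_of_AvgDeltaP) : Hirahara2018_gapMINKT_mem_PromiseZPP :=
  Hirahara2018_gapMINKT_mem_PromiseZPP_of Hirahara2018_MINKTr_DKT_mem_AvgDeltaP_holds h421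
    Hirahara2018_gapMINKT_mem_PromiseZPP_of_search_holds isPolyTimeUnary₂_sigmaBound
    isPolyTimeUnary₂_eval_add

end Literature.Computability.MetaComplexity
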